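import Literature.NumberTheory.EllipticCurves.IwasawaAlgebraDivisibilityProofs
import Literature.NumberTheory.EllipticCurves.IwasawaAlgebraRankOneIdealProofs
import Literature.NumberTheory.EllipticCurves.IwasawaAlgebra
import Literature.NumberTheory.EllipticCurves.PAdicBSD
import HarnessLib

/-!
# Crux K1 `SprungLowerDivisibilityAtThree` (stmt-BirchSwinnertonDyer-19875), line `chromatic-common-zeros`:
# the GLOBALISATION step of stub S1 `stub_squeezeToCommonZeros` — from the local Eisenstein
# inequalities `length_𝔭(Λ/(G)) ≤ length_𝔭(X)` at every height-one prime to `G ∣ gen(char_Λ X)`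
# (generic commutative algebra; `--supports` 19875, closes nothing by itself)

The Eisenstein twin of the tree's Kato-direction bridge
`Literature.NumberTheory.EllipticCurves.Module.exists_pow_mul_mem_charIdeal_of_lengthAt_le`
(`length X_𝔭 ≤ length (R/G)_𝔭` off `π₀` ⟹ `π₀^m G ∈ char X`). Here the inequalities go the other
way and hold at EVERY height-one prime, and the conclusion is the divisibility the Eisenstein half
(MC↓•) of Sprung's ♯/♭ main conjecture is stated in (`Theorems.SprungSharpFlatLowerDivisibility`:
`char X^• = (gen)` with `ι gen = C(ϖ)·ι(L^• · h)`):

* `charIdeal_le_span_singleton_of_lengthAt_quotient_le` — over a Noetherian UFD `R`, for a finitely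
  generated torsion module `X` and `G ≠ 0`: if `length_{R_𝔭}(R/(G))_𝔭 ≤ length_{R_𝔭} X_𝔭` at every
  height-one prime `𝔭`, then `char_R(X) ⊆ (G)`. Proof: `char_R(R/(G)) = (G)`
  (`Module.charIdeal_quotient_span_singleton`, Washington §13.2) and `char` is the product
  `∏_{ht 𝔭 = 1} 𝔭^{length(·)_𝔭}`, antitone in the exponents.
* `exists_generator_eq_mul_of_lengthAt_quotient_le` — over `Λ = ℤ_p⟦T⟧` (where `char` is principal,
  `charIdeal_isPrincipal_holds`): `char_Λ(X) = (G · h)` for some `h`.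
* `exists_generator_eq_periodNormalised_mul_of_lengthAt_quotient_le` — the same in the currency of
  `SprungSharpFlatLowerDivisibility` / stub S1: if `ι G = C(ϖ)·ι L` then
  `∃ gen h, char_Λ(X) = (gen) ∧ ι gen = C(ϖ)·ι(L·h)`.
* `ne_zero_of_lengthAt_quotient_le` — the hypothesis itself forces `G ≠ 0` over `Λ` (at `𝔭 = (p)` the
  module `Λ/(0) = Λ` has infinite local length, a f.g. torsion `X` has finite local length).

Pure algebra (Bourbaki AC VII §4.4–4.5; Washington §13.2); no arithmetic input, no named fact.
K1 and BSD on leaf X8 are NOT proved by this file.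
-/

set_option autoImplicit false
-- justification: the mandated namespace `Summit.BirchSwinnertonDyer.BirchSwinnertonDyer.Theorems`
-- (single-conjunct summit, Sub = Summit) repeats a segment by design (D-0017).
set_option linter.dupNamespace false

noncomputable section

open Literature.NumberTheory.EllipticCurves Literature.NumberTheory.EllipticCurves.Module
  Literature.NumberTheory.EllipticCurves.IwasawaAlgebra

namespace Summit.BirchSwinnertonDyer.BirchSwinnertonDyer.Theorems.ChromaticCommonZeros

/-! ### Generic: `char_R(X) ⊆ (G)` from the local inequalities -/

section Generic

variable {R : Type*} [CommRing R]

/-- Products of ideals over a finset are monotone factorwise. [folklore] -/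
theorem finset_prod_ideal_mono {ι : Type*} (t : Finset ι) {f g : ι → Ideal R}
    (h : ∀ i ∈ t, f i ≤ g i) : ∏ i ∈ t, f i ≤ ∏ i ∈ t, g i := by
  classical
  induction t using Finset.induction_on with
  | empty => simp
  | insert a t ha ih =>
    rw [Finset.prod_insert ha, Finset.prod_insert ha]
    exact Ideal.mul_mono (h a (Finset.mem_insert_self a t))
      (ih fun i hi => h i (Finset.mem_insert_of_mem hi))

/-- `R/(G)` is killed by `G`. [folklore] -/
theorem isTorsionBy_quotient_span_singleton (G : R) :
    Module.IsTorsionBy R (R ⧸ Ideal.span {G}) G := by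
  intro x
  obtain ⟨r, rfl⟩ := Ideal.Quotient.mk_surjective x
  rw [Algebra.smul_def, Ideal.Quotient.algebraMap_eq, ← map_mul, Ideal.Quotient.eq_zero_iff_mem]
  exact Ideal.mul_mem_right _ _ (Ideal.mem_span_singleton_self G)

variable [IsDomain R] [IsNoetherianRing R]

/-- **The Eisenstein twin of the length-to-divisibility bridge.** Let `R` be a Noetherian UFD, `X` a
finitely generated torsion `R`-module and `G ≠ 0`. If `length_{R_𝔭}(R/(G))_𝔭 ≤ length_{R_𝔭} X_𝔭` at
every height-one prime `𝔭` of `R`, then `char_R(X) ⊆ (G)` — i.e. `G` divides every generator of the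
characteristic ideal. Proof: both sides are `∏_{ht 𝔭 = 1} 𝔭^{length(·)_𝔭}` — the right side by
`char_R(R/(G)) = (G)` (Washington §13.2: the characteristic power series of `Λ/(f)` is `f`) — over a
common finite set of height-one primes, and `𝔭^n ⊆ 𝔭^e` for `e ≤ n`. (Bourbaki AC VII §4.5; the
twin of Kato's printed form of Thm. 17.4 (2), cf. `Module.exists_pow_mul_mem_charIdeal_of_lengthAt_le`.)
[cite: Washington1997, §13.2] [cite: BourbakiAC5to7, Ch. VII §4 no. 5] -/
theorem charIdeal_le_span_singleton_of_lengthAt_quotient_le [UniqueFactorizationMonoid R]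
    {X : Type*} [AddCommGroup X] [Module R X] [Module.Finite R X]
    (hX : Module.IsTorsion R X) {G : R} (hG : G ≠ 0)
    (h : ∀ 𝔭 : PrimeSpectrum R, 𝔭.asIdeal.height = 1 →
      lengthAt R (R ⧸ Ideal.span {G}) 𝔭 ≤ lengthAt R X 𝔭) :
    charIdeal R X ≤ Ideal.span {G} := by
  classical
  rw [← charIdeal_quotient_span_singleton hG]
  -- one `s ≠ 0` kills the finitely generated torsion module `X`; `G` kills `R/(G)`
  obtain ⟨s, hsann, hs0⟩ := Submodule.annihilator_top_inter_nonZeroDivisors hX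
  have hs : s ≠ 0 := nonZeroDivisors.ne_zero hs0
  have hsX : Module.IsTorsionBy R X s := fun x =>
    Submodule.mem_annihilator.mp hsann x Submodule.mem_top
  have hGX : Module.IsTorsionBy R (R ⧸ Ideal.span {G}) G := isTorsionBy_quotient_span_singleton G
  -- the two exponent functions and their (finite) height-one supports
  set FX : PrimeSpectrum R → Ideal R := fun 𝔭 => 𝔭.asIdeal ^ (lengthAt R X 𝔭).toNat with hFX
  set FG : PrimeSpectrum R → Ideal R :=
    fun 𝔭 => 𝔭.asIdeal ^ (lengthAt R (R ⧸ Ideal.span {G}) 𝔭).toNat with hFG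
  set H1 : Set (PrimeSpectrum R) := {𝔭 | 𝔭.asIdeal.height = 1} with hH1
  have hfinX : (H1 ∩ Function.mulSupport FX).Finite := finite_heightOne_inter_mulSupport hs hsX
  have hfinG : (H1 ∩ Function.mulSupport FG).Finite := finite_heightOne_inter_mulSupport hG hGX
  set t : Finset (PrimeSpectrum R) := hfinX.toFinset ∪ hfinG.toFinset with ht
  have hmemt : ∀ 𝔭, 𝔭 ∈ (t : Set (PrimeSpectrum R)) ↔
      (𝔭 ∈ H1 ∧ 𝔭 ∈ Function.mulSupport FX) ∨ (𝔭 ∈ H1 ∧ 𝔭 ∈ Function.mulSupport FG) := by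
    intro 𝔭
    rw [Finset.mem_coe, ht, Finset.mem_union, Set.Finite.mem_toFinset, Set.Finite.mem_toFinset,
      Set.mem_inter_iff, Set.mem_inter_iff]
  have htH1 : ∀ 𝔭 ∈ t, 𝔭.asIdeal.height = 1 := by
    intro 𝔭 h𝔭
    rcases (hmemt 𝔭).mp (Finset.mem_coe.mpr h𝔭) with h𝔭 | h𝔭 <;> exact h𝔭.1
  have hXprod : charIdeal R X = ∏ 𝔭 ∈ t, FX 𝔭 := by
    unfold charIdeal
    refine finprod_mem_eq_prod_of_inter_mulSupport_eq FX ?_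
    ext 𝔭
    rw [Set.mem_inter_iff, Set.mem_inter_iff, hmemt]
    tauto
  have hGprod : charIdeal R (R ⧸ Ideal.span {G}) = ∏ 𝔭 ∈ t, FG 𝔭 := by
    unfold charIdeal
    refine finprod_mem_eq_prod_of_inter_mulSupport_eq FG ?_
    ext 𝔭
    rw [Set.mem_inter_iff, Set.mem_inter_iff, hmemt]
    tauto
  rw [hXprod, hGprod]
  refine finset_prod_ideal_mono t fun 𝔭 h𝔭 => ?_
  -- `𝔭^{n_X} ≤ 𝔭^{n_G}` since `n_G ≤ n_X` (the length of `X` at a height-one prime is finite)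
  refine Ideal.pow_le_pow_right ?_
  have hfin : lengthAt R X 𝔭 ≠ ⊤ := lengthAt_ne_top_of_isTorsionBy hs hsX 𝔭 (le_of_eq (htH1 𝔭 h𝔭))
  exact ENat.toNat_le_toNat (h 𝔭 (htH1 𝔭 h𝔭)) hfin

end Generic

/-! ### Over `Λ = ℤ_p⟦T⟧`: a generator divisible by `G`, in the period-normalised currency -/

section Iwasawa

variable {p : ℕ} [Fact p.Prime] {X : Type*} [AddCommGroup X] [Module (IwasawaAlgebra p) X]

/-- **Generator form over `Λ`.** For a finitely generated torsion `Λ`-module `X` and `G ≠ 0` with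
`length_𝔭(Λ/(G)) ≤ length_𝔭(X)` at every height-one prime `𝔭`: `char_Λ(X) = (G · h)` for some `h ∈ Λ`
(`char_Λ` is principal, `charIdeal_isPrincipal_holds`; containment by
`charIdeal_le_span_singleton_of_lengthAt_quotient_le`). [cite: Washington1997, §13.2] -/
theorem exists_generator_eq_mul_of_lengthAt_quotient_le [Module.Finite (IwasawaAlgebra p) X]
    (hX : Module.IsTorsion (IwasawaAlgebra p) X) {G : IwasawaAlgebra p} (hG : G ≠ 0)
    (h : ∀ 𝔭 : PrimeSpectrum (IwasawaAlgebra p), 𝔭.asIdeal.height = 1 →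
      lengthAt (IwasawaAlgebra p) (IwasawaAlgebra p ⧸ Ideal.span {G}) 𝔭 ≤
        lengthAt (IwasawaAlgebra p) X 𝔭) :
    ∃ gen h : IwasawaAlgebra p, charIdeal (IwasawaAlgebra p) X = Ideal.span {gen} ∧ gen = G * h := by
  have hprin : (charIdeal (IwasawaAlgebra p) X).IsPrincipal := charIdeal_isPrincipal_holds p X
  obtain ⟨gen, hgen⟩ := hprin
  have hgen' : charIdeal (IwasawaAlgebra p) X = Ideal.span {gen} := hgen
  have hle := charIdeal_le_span_singleton_of_lengthAt_quotient_le hX hG h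
  rw [hgen', Ideal.span_singleton_le_span_singleton] at hle
  obtain ⟨h, hh⟩ := hle
  exact ⟨gen, h, hgen', hh⟩

/-- **The hypothesis forces `G ≠ 0` over `Λ`.** If `X` is a finitely generated torsion `Λ`-module and
`length_𝔭(Λ/(G)) ≤ length_𝔭(X)` at every height-one prime, then `G ≠ 0`: at `𝔭 = (p)` (height one,
`height_augIdealP_holds`) a f.g. torsion module has finite local length, whereas `Λ/(0) ≅ Λ` has
infinite local length (`Λ_{(p)}` is a one-dimensional local domain, not Artinian). [cite: Washington1997, §13.2] -/
theorem ne_zero_of_lengthAt_quotient_le [Module.Finite (IwasawaAlgebra p) X]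
    (hX : Module.IsTorsion (IwasawaAlgebra p) X) {G : IwasawaAlgebra p}
    (h : ∀ 𝔭 : PrimeSpectrum (IwasawaAlgebra p), 𝔭.asIdeal.height = 1 →
      lengthAt (IwasawaAlgebra p) (IwasawaAlgebra p ⧸ Ideal.span {G}) 𝔭 ≤
        lengthAt (IwasawaAlgebra p) X 𝔭) :
    G ≠ 0 := by
  intro hG0
  haveI : (augIdealP p).IsPrime := isPrime_augIdealP_holds p
  set 𝔭 : PrimeSpectrum (IwasawaAlgebra p) := ⟨augIdealP p, inferInstance⟩ with h𝔭
  have h1 : 𝔭.asIdeal.height = 1 := height_augIdealP_holds p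
  -- finite length of `X` at `(p)`
  obtain ⟨s, hsann, hs0⟩ := Submodule.annihilator_top_inter_nonZeroDivisors hX
  have hs : s ≠ 0 := nonZeroDivisors.ne_zero hs0
  have hsX : Module.IsTorsionBy (IwasawaAlgebra p) X s := fun x =>
    Submodule.mem_annihilator.mp hsann x Submodule.mem_top
  have hfin : lengthAt (IwasawaAlgebra p) X 𝔭 ≠ ⊤ :=
    lengthAt_ne_top_of_isTorsionBy hs hsX 𝔭 (le_of_eq h1)
  -- infinite length of `Λ/(0)` at `(p)`: it surjects onto `Λ/(p^n)` of length `n`, for every `n`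
  have hinf : lengthAt (IwasawaAlgebra p) (IwasawaAlgebra p ⧸ Ideal.span {G}) 𝔭 = ⊤ := by
    rw [hG0]
    refine ENat.eq_top_iff_forall_ge.mpr fun n => ?_
    have hle : Ideal.span {(0 : IwasawaAlgebra p)} ≤ Ideal.span {PowerSeries.C (p : ℤ_[p]) ^ n} := by
      rw [Ideal.span_singleton_le_span_singleton]; exact dvd_zero _
    have hsurj : Function.Surjective
        (Ideal.Quotient.factorₐ (IwasawaAlgebra p) hle).toLinearMap :=
      Ideal.Quotient.factor_surjective hle
    refine le_trans ?_ (lengthAt_le_of_surjective _ hsurj 𝔭)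
    have hC : (PowerSeries.C (p : ℤ_[p]) : IwasawaAlgebra p) ≠ 0 := by
      rw [Ne, ← map_zero (PowerSeries.C (R := ℤ_[p])), PowerSeries.C_injective.eq_iff]
      exact_mod_cast (Fact.out : p.Prime).ne_zero
    rw [lengthAt_quotient_span_singleton_pow hC n 𝔭,
      show lengthAt (IwasawaAlgebra p) (IwasawaAlgebra p ⧸ Ideal.span {PowerSeries.C (p : ℤ_[p])}) 𝔭
          = 1 from lengthAt_quotient_self 𝔭]
    simp
  have := h 𝔭 h1
  rw [hinf, top_le_iff] at this
  exact hfin this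

/-- **The globalisation step of stub S1, in the currency of `SprungSharpFlatLowerDivisibility`.** Let
`X` be a finitely generated torsion `Λ`-module (for S1: `X = X^•(E/ℚ_∞) = D.X`, torsion by Sprung 2012
Thm. 7.14), `L ∈ Λ` (for S1: `L = chromaticL • L♯ L♭ ≠ 0`), `ϖ ∈ ℚ` and `G ∈ Λ` the Néron-normalised
function, `ι G = C(ϖ)·ι L` (`ι = iwasawaToPowerSeries p`). If `length_𝔭(Λ/(G)) ≤ length_𝔭(X)` at every
height-one prime `𝔭`, then `char_Λ(X) = (gen)` with `ι gen = C(ϖ)·ι(L·h)` for some `h ∈ Λ` — the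
displayed conclusion of the Eisenstein half. [cite: Washington1997, §13.2]
[cite: Sprung2012, Main Conj. 7.21 (p. 1505) and Prop. 7.19] -/
theorem exists_generator_eq_periodNormalised_mul_of_lengthAt_quotient_le
    [Module.Finite (IwasawaAlgebra p) X] (hX : Module.IsTorsion (IwasawaAlgebra p) X)
    {G L : IwasawaAlgebra p} {ϖ : ℚ}
    (hGι : iwasawaToPowerSeries p G = PowerSeries.C (ϖ : ℚ_[p]) * iwasawaToPowerSeries p L)
    (h : ∀ 𝔭 : PrimeSpectrum (IwasawaAlgebra p), 𝔭.asIdeal.height = 1 →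
      lengthAt (IwasawaAlgebra p) (IwasawaAlgebra p ⧸ Ideal.span {G}) 𝔭 ≤
        lengthAt (IwasawaAlgebra p) X 𝔭) :
    ∃ gen h : IwasawaAlgebra p, charIdeal (IwasawaAlgebra p) X = Ideal.span {gen} ∧
      iwasawaToPowerSeries p gen =
        PowerSeries.C (ϖ : ℚ_[p]) * iwasawaToPowerSeries p (L * h) := by
  have hG : G ≠ 0 := ne_zero_of_lengthAt_quotient_le hX h
  obtain ⟨gen, h', hgen, rfl⟩ := exists_generator_eq_mul_of_lengthAt_quotient_le hX hG h
  refine ⟨G * h', h', hgen, ?_⟩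
  rw [map_mul, hGι, map_mul, mul_assoc]

end Iwasawa

end Summit.BirchSwinnertonDyer.BirchSwinnertonDyer.Theorems.ChromaticCommonZeros

end
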